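import Summits.CriticalPhenomena.PercolationContinuityZ3.Theorems.PercNearOneGluingNoHeavyLowerTailSahiE3CovHit
import Literature.Probability.LatticeModels.SahiThirdOrderCorrelation
import Mathlib.Combinatorics.SetFamily.FourFunctions
import Mathlib.Tactic.Linarith
import Mathlib.Tactic.Ring
import Mathlib.Tactic.Positivity
import Mathlib.Tactic.FieldSimp
import HarnessLib
import HarnessLib.Audit

/-!
# `NoHeavyLowerTail` (crux stmt-CriticalPhenomena-4575), Sahi programme P4 (Holley / monotone coupling):
# a quantitative FKG inequality for a split pair — `Cov(↑c, ↑c') ≥ μ(⊥)·μ(c ⊔ c') − μ(c)·μ(c')`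

Support file (cell `prim-l12`, seat P4, generation 7; `--supports stmt-CriticalPhenomena-4575`).  No named facts, no sorries; standard
axioms; def-free.

## The inequality (new; tight on every product measure)

Let `L` be a finite distributive lattice with bottom `⊥`, `μ ≥ 0` log-supermodular (not normalised, `Z = m(L)`), and `c, c'` with
`c ⊓ c' = ⊥`, `b = c ⊔ c'`.  Then

  `cov_principalUp_ge_split`:  `Z·m(↑c ∩ ↑c') − m(↑c)·m(↑c') ≥ μ(⊥)·μ(b) − μ(c)·μ(c')`.

The right-hand side is the defect of the lattice condition on the single "bottom square" `(⊥, c, c', b)`; for a product measure on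
`2^ι` with `c, c'` disjoint sets both sides vanish.  So: two principal up-sets of "disjoint" generators are positively correlated at
least as much as the bottom square `{⊥, c, c', c ⊔ c'}` fails to be a product.

Proof: with the four blocks `Q₁₀ = ↑c ∖ ↑c'`, `Q₀₁ = ↑c' ∖ ↑c`, `Q₁₁ = ↑b`, `Q₀₀ = L ∖ (↑c ∪ ↑c')` one has
`Z·m(Q₁₁) − m(↑c)m(↑c') = m(Q₀₀)m(Q₁₁) − m(Q₁₀)m(Q₀₁)`, and the four functions theorem [Ahlswede–Daykin] with `f₁ = μ·1_{Q₁₀}`,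
`f₂ = μ·1_{Q₀₁}`, `f₄ = μ·1_{Q₁₁}` and the MODIFIED `f₃ = μ·1_{Q₀₀}` except `f₃(⊥) = μ(c)μ(c')/μ(b)` gives
`m(Q₁₀)m(Q₀₁) ≤ (m(Q₀₀) − μ(⊥) + μ(c)μ(c')/μ(b))·m(Q₁₁)`: the only new pointwise check is for `x ∈ Q₁₀`, `y ∈ Q₀₁` with
`x ⊓ y = ⊥`, where distributivity gives `x ⊓ b = c`, `(x ⊔ b) ⊓ y = c'` and two applications of the lattice condition give
`μ(x)μ(y)μ(b) ≤ μ(c)μ(c')μ(x ⊔ y)`.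

Role: the "deficit lemma" shape of the k-join-prime programme (HOME prim-l12-p4/RHO-LEMMA-gen6.md, Addendum 4): an element
`b = c ⊔ c'` of the pattern may stay unsaturated in a certificate only to the extent that `↑c` and `↑c'` are correlated.
-/

namespace Summit.CriticalPhenomena.PercolationContinuityZ3.Theorems.SahiE3CovSplit

open Finset Literature.Probability.LatticeModels
open scoped BigOperators

variable {α : Type*} [DistribLattice α] [OrderBot α] [Fintype α] [DecidableEq α] [DecidableLE α]

omit [Fintype α] [DecidableEq α] [DecidableLE α] in
/-- The pointwise estimate for a disjoint pair: `x ≥ c`, `y ≥ c'`, `x ⊓ y = ⊥`, `c ⊓ c' = ⊥` ⟹ `μ(x)μ(y)μ(c ⊔ c') ≤ μ(c)μ(c')μ(x ⊔ y)`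
(two applications of the lattice condition, using `x ⊓ (c ⊔ c') = c` and `(x ⊔ c ⊔ c') ⊓ y = c'`). [this work] -/
theorem mul_mul_le_of_inf_eq_bot {μ : α → ℝ} (hμ₀ : 0 ≤ μ) (hμ : ∀ a b, μ a * μ b ≤ μ (a ⊓ b) * μ (a ⊔ b))
    {c c' x y : α} (hcx : c ≤ x) (hcy : c' ≤ y) (hxy : x ⊓ y = ⊥) :
    μ x * μ y * μ (c ⊔ c') ≤ μ c * μ c' * μ (x ⊔ y) := by
  have hxc' : x ⊓ c' = ⊥ := le_bot_iff.1 (le_trans (inf_le_inf_left x hcy) hxy.le)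
  have hyc : c ⊓ y = ⊥ := le_bot_iff.1 (le_trans (inf_le_inf_right y hcx) hxy.le)
  have e1 : x ⊓ (c ⊔ c') = c := by rw [inf_sup_left, hxc', sup_bot_eq, inf_eq_right.2 hcx]
  have e2 : (x ⊔ (c ⊔ c')) ⊓ y = c' := by
    rw [inf_comm, inf_sup_left, inf_sup_left, inf_comm y x, hxy, inf_comm y c, hyc, bot_sup_eq, bot_sup_eq,
      inf_eq_right.2 hcy]
  have e3 : x ⊔ (c ⊔ c') ⊔ y = x ⊔ y := by
    apply le_antisymm
    · exact sup_le (sup_le le_sup_left (sup_le (le_trans hcx le_sup_left) (le_trans hcy le_sup_right))) le_sup_right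
    · exact sup_le (le_trans le_sup_left le_sup_left) le_sup_right
  have h1 := hμ x (c ⊔ c')
  rw [e1] at h1
  have h2 := hμ (x ⊔ (c ⊔ c')) y
  rw [e2, e3] at h2
  calc μ x * μ y * μ (c ⊔ c') = (μ x * μ (c ⊔ c')) * μ y := by ring
    _ ≤ (μ c * μ (x ⊔ (c ⊔ c'))) * μ y := mul_le_mul_of_nonneg_right h1 (hμ₀ y)
    _ = μ c * (μ (x ⊔ (c ⊔ c')) * μ y) := by ring
    _ ≤ μ c * (μ c' * μ (x ⊔ y)) := mul_le_mul_of_nonneg_left h2 (hμ₀ c)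
    _ = μ c * μ c' * μ (x ⊔ y) := by ring

/-- **`Z·m(↑c ∩ ↑c') − m(↑c)·m(↑c') ≥ μ(⊥)·μ(c ⊔ c') − μ(c)·μ(c')`** for `c ⊓ c' = ⊥` under a nonnegative log-supermodular weight
on a finite distributive lattice: the covariance of two principal up-sets with disjoint generators is at least the defect of the
lattice condition on the bottom square.  Equality for product measures on `2^ι`. [this work] -/
theorem cov_principalUp_ge_split {μ : α → ℝ} (hμ₀ : 0 ≤ μ) (hμ : ∀ a b, μ a * μ b ≤ μ (a ⊓ b) * μ (a ⊔ b))
    {c c' : α} (hcc' : c ⊓ c' = ⊥) :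
    μ ⊥ * μ (c ⊔ c') - μ c * μ c' ≤
      mass μ univ * mass μ (principalUp c ∩ principalUp c') - mass μ (principalUp c) * mass μ (principalUp c') := by
  have hμ₀' : ∀ x, (0 : ℝ) ≤ μ x := fun x => hμ₀ x
  -- degenerate generators
  have hU : ∀ d : α, d = ⊥ → principalUp d = univ := by
    intro d hd; ext x; simp [mem_principalUp, hd]
  by_cases hc : c = ⊥
  · rw [hU c hc, Finset.univ_inter, hc, bot_sup_eq]; nlinarith [hμ₀ ⊥, hμ₀ c']
  by_cases hc' : c' = ⊥
  · rw [hU c' hc', Finset.inter_univ, hc', sup_bot_eq]; nlinarith [hμ₀ ⊥, hμ₀ c]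
  -- the trivial case `μ(c ⊔ c') = 0`
  have hfkg := fkg_upperSet_mass hμ₀ hμ (isUpperSet_principalUp c) (isUpperSet_principalUp c')
  have hsq : μ c * μ c' ≤ μ ⊥ * μ (c ⊔ c') := by have h := hμ c c'; rwa [hcc'] at h
  rcases (hμ₀' (c ⊔ c')).eq_or_lt with hb0 | hbpos
  · rw [← hb0, mul_zero] at hsq ⊢; linarith [mul_nonneg (hμ₀' c) (hμ₀' c')]
  -- the four blocks
  set W : Finset α := principalUp c ∩ principalUp c' with hW
  set Q₁₀ : Finset α := principalUp c \ principalUp c' with hQ₁₀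
  set Q₀₁ : Finset α := principalUp c' \ principalUp c with hQ₀₁
  set Q₀₀ : Finset α := univ \ (principalUp c ∪ principalUp c') with hQ₀₀
  have eC : mass μ (principalUp c) = mass μ Q₁₀ + mass μ W := by
    rw [hQ₁₀, hW, ← SahiE3CovHit.mass_union_of_disjoint μ (Finset.disjoint_sdiff_inter _ _), Finset.sdiff_union_inter]
  have eC' : mass μ (principalUp c') = mass μ Q₀₁ + mass μ W := by
    rw [hQ₀₁, hW, Finset.inter_comm, ← SahiE3CovHit.mass_union_of_disjoint μ (Finset.disjoint_sdiff_inter _ _),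
      Finset.sdiff_union_inter]
  have eZ : mass μ univ = mass μ Q₀₀ + mass μ (principalUp c ∪ principalUp c') := by
    rw [hQ₀₀, ← SahiE3CovHit.mass_union_of_disjoint μ Finset.sdiff_disjoint, Finset.sdiff_union_of_subset (subset_univ _)]
  have eU : mass μ (principalUp c ∪ principalUp c') + mass μ W = mass μ (principalUp c) + mass μ (principalUp c') := by
    rw [hW]; unfold mass; exact Finset.sum_union_inter
  have memQ₁₀ : ∀ x, x ∈ Q₁₀ ↔ c ≤ x ∧ ¬ c' ≤ x := fun x => by simp [hQ₁₀, Finset.mem_sdiff, mem_principalUp]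
  have memQ₀₁ : ∀ x, x ∈ Q₀₁ ↔ c' ≤ x ∧ ¬ c ≤ x := fun x => by simp [hQ₀₁, Finset.mem_sdiff, mem_principalUp]
  have memQ₀₀ : ∀ x, x ∈ Q₀₀ ↔ ¬ c ≤ x ∧ ¬ c' ≤ x := fun x => by
    simp [hQ₀₀, Finset.mem_sdiff, mem_principalUp, not_or]
  have memW : ∀ x, x ∈ W ↔ c ≤ x ∧ c' ≤ x := fun x => by simp [hW, mem_principalUp]
  have hbotQ : ⊥ ∈ Q₀₀ := by
    rw [memQ₀₀]; exact ⟨fun h => hc (le_bot_iff.1 h), fun h => hc' (le_bot_iff.1 h)⟩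
  have hbW : c ⊔ c' ∈ W := (memW _).2 ⟨le_sup_left, le_sup_right⟩
  -- the four functions with a modified bottom value
  set v : ℝ := μ c * μ c' / μ (c ⊔ c') with hv
  have hv0 : 0 ≤ v := div_nonneg (mul_nonneg (hμ₀' c) (hμ₀' c')) (hμ₀' _)
  have hvb : v * μ (c ⊔ c') = μ c * μ c' := div_mul_cancel₀ _ hbpos.ne'
  set f₁ : α → ℝ := fun x => if x ∈ Q₁₀ then μ x else 0 with hf₁
  set f₂ : α → ℝ := fun x => if x ∈ Q₀₁ then μ x else 0 with hf₂
  set f₃ : α → ℝ := fun x => if x ∈ Q₀₀ then (if x = ⊥ then v else μ x) else 0 with hf₃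
  set f₄ : α → ℝ := fun x => if x ∈ W then μ x else 0 with hf₄
  have hf₁0 : 0 ≤ f₁ := fun x => by show (0 : ℝ) ≤ f₁ x; simp only [hf₁]; split_ifs; exacts [hμ₀' x, le_rfl]
  have hf₂0 : 0 ≤ f₂ := fun x => by show (0 : ℝ) ≤ f₂ x; simp only [hf₂]; split_ifs; exacts [hμ₀' x, le_rfl]
  have hf₃0 : 0 ≤ f₃ := fun x => by show (0 : ℝ) ≤ f₃ x; simp only [hf₃]; split_ifs; exacts [hv0, hμ₀' x, le_rfl]
  have hf₄0 : 0 ≤ f₄ := fun x => by show (0 : ℝ) ≤ f₄ x; simp only [hf₄]; split_ifs; exacts [hμ₀' x, le_rfl]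
  have key := four_functions_theorem_univ f₁ f₂ f₃ f₄ hf₁0 hf₂0 hf₃0 hf₄0 (by
    intro x y
    by_cases hx : x ∈ Q₁₀
    · by_cases hy : y ∈ Q₀₁
      · have hx' := (memQ₁₀ x).1 hx
        have hy' := (memQ₀₁ y).1 hy
        have hmeet : x ⊓ y ∈ Q₀₀ :=
          (memQ₀₀ _).2 ⟨fun h => hy'.2 (le_trans h inf_le_right), fun h => hx'.2 (le_trans h inf_le_left)⟩
        have hjoin : x ⊔ y ∈ W := (memW _).2 ⟨le_trans hx'.1 le_sup_left, le_trans hy'.1 le_sup_right⟩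
        simp only [hf₁, hf₂, hf₃, hf₄, if_pos hx, if_pos hy, if_pos hmeet, if_pos hjoin]
        by_cases hb : x ⊓ y = ⊥
        · rw [if_pos hb, hv, div_mul_eq_mul_div, le_div_iff₀ hbpos]
          exact mul_mul_le_of_inf_eq_bot hμ₀ hμ hx'.1 hy'.1 hb
        · rw [if_neg hb]; exact hμ x y
      · simp only [hf₂, if_neg hy, mul_zero]; exact mul_nonneg (hf₃0 _) (hf₄0 _)
    · simp only [hf₁, if_neg hx, zero_mul]; exact mul_nonneg (hf₃0 _) (hf₄0 _))
  -- evaluate the four sums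
  have s₁ : ∑ x, f₁ x = mass μ Q₁₀ := by simp only [hf₁]; rw [Finset.sum_ite_mem, Finset.univ_inter]; rfl
  have s₂ : ∑ x, f₂ x = mass μ Q₀₁ := by simp only [hf₂]; rw [Finset.sum_ite_mem, Finset.univ_inter]; rfl
  have s₄ : ∑ x, f₄ x = mass μ W := by simp only [hf₄]; rw [Finset.sum_ite_mem, Finset.univ_inter]; rfl
  have s₃ : ∑ x, f₃ x = mass μ Q₀₀ - μ ⊥ + v := by
    simp only [hf₃]
    rw [Finset.sum_ite_mem, Finset.univ_inter, ← Finset.add_sum_erase Q₀₀ _ hbotQ, if_pos rfl]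
    have e : ∑ x ∈ Q₀₀.erase ⊥, (if x = ⊥ then v else μ x) = ∑ x ∈ Q₀₀.erase ⊥, μ x :=
      Finset.sum_congr rfl fun x hx => if_neg (Finset.ne_of_mem_erase hx)
    rw [e]
    have e2 : mass μ Q₀₀ = μ ⊥ + ∑ x ∈ Q₀₀.erase ⊥, μ x := by
      unfold mass; rw [Finset.add_sum_erase Q₀₀ μ hbotQ]
    rw [e2]; ring
  rw [s₁, s₂, s₃, s₄] at key
  have hWb : μ (c ⊔ c') ≤ mass μ W := by
    have := mass_mono hμ₀ (Finset.singleton_subset_iff.2 hbW)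
    unfold mass at this ⊢; simpa using this
  have hW0 : 0 ≤ mass μ W := mass_nonneg hμ₀ W
  -- assemble: Cov = m(Q₀₀)m(W) − m(Q₁₀)m(Q₀₁) ≥ (μ⊥ − v)·m(W) ≥ (μ⊥ − v)·μ(c ⊔ c')
  have hgap : 0 ≤ μ ⊥ - v := by
    rw [sub_nonneg, hv, div_le_iff₀ hbpos]; linarith
  rw [eZ, eC, eC']
  nlinarith [key, eU, mul_le_mul_of_nonneg_left hWb hgap, hvb]

end Summit.CriticalPhenomena.PercolationContinuityZ3.Theorems.SahiE3CovSplit
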